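import Literature.Geometry.Riemannian.GraphMeanCurvatureSecondDerivatives
import Literature.Geometry.Riemannian.GraphNormalVelocityK2Alpha
import HarnessLib

/-!
# The nonparametric mean curvature flow system (White 2005, §8.4), pointwise algebraic form

Topic `Literature/Geometry/Riemannian`.  We assemble `GraphMeanCurvatureSecondDerivatives.lean`
(the normal part of `∑ᵢ D²f(bᵢ, bᵢ)` is the mean curvature vector `H⃗ = -H₁ν₁ - H₂ν₂`,
codimension two) with White's velocity identity (`GraphNormalVelocityK2Alpha.lean`) into the
pointwise content of the nonparametric system (White 2005, (11) p. 1505): for the graph map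
`f = L + u` of `u : E' → Kᗮ` over the plane `K = range L` (`L` a linear isometry), an
`f^*δ`-orthonormal basis `b` of `E'` at `y`, and ANY vertical vector `w ∈ Kᗮ` (meant: the vertical
velocity `∂ₜu(y, t)`),

  `w - ∑ᵢ D²u(y)(bᵢ, bᵢ) = P_{Kᗮ} β - Du(y) (L† β)`,  `β := P_{Tᗮ} w - H⃗(y)`,

`T = T_{f y} = range df_y` (`vertical_sub_sum_iteratedFDeriv_eq`).  When `w = ∂ₜu` and the graph
moves by mean curvature plus a normal forcing `β`, `P_{Tᗮ} w` is the normal velocity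
(`velocity_eq_starProjection_vertical`) and `β = P_{Tᗮ}w - H⃗` IS the forcing, so this is
`∂ₜu - g^{ij} D_{ij} u = π′β - Du ∘ πβ` written invariantly (`∑ᵢ D²u(bᵢ, bᵢ) = g^{ij} D_{ij} u`).

Everything is PROVED; no definitions, no named facts.

## References

* B. White, *A local regularity theorem for mean curvature flow*, Ann. of Math. 161 (2005),
  §8.4, p. 1505 (11)–(12). [White2005]
-/

noncomputable section

open Bundle Set Function Module Filter
open scoped Manifold ContDiff Topology RealInnerProductSpace

namespace Literature.Geometry.Riemannian

open Lorentzian Lorentzian.PseudoRiemannianMetric Submodule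

variable {E' V : Type*} [NormedAddCommGroup E'] [InnerProductSpace ℝ E'] [FiniteDimensional ℝ E']
  [NormedAddCommGroup V] [InnerProductSpace ℝ V] [FiniteDimensional ℝ V]

omit [FiniteDimensional ℝ E'] [FiniteDimensional ℝ V] in
/-- Second derivatives of a map with values in a closed subspace stay in it: if `u x ∈ Kᗮ` for all
`x` (`K` with orthogonal projection) then `D²u(y)(m) ∈ Kᗮ`. [folklore] -/
theorem iteratedFDeriv_two_mem_orthogonal (K : Submodule ℝ V) [K.HasOrthogonalProjection]
    {u : E' → V} (hu : ContDiff ℝ 2 u) (hK : ∀ x, u x ∈ Kᗮ) (y : E') (m : Fin 2 → E') :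
    iteratedFDeriv ℝ 2 u y m ∈ Kᗮ := by
  -- `P_K ∘ u = 0`, so `P_K (D²u m) = D²(P_K ∘ u) m = 0`
  have h0 : (fun x => K.starProjection (u x)) = fun _ => (0 : V) := by
    funext x
    rw [starProjection_apply, (orthogonalProjectionOnto_eq_zero_iff).2 (hK x), coe_zero]
  have h1 : iteratedFDeriv ℝ 2 (fun x => K.starProjection (u x)) y m =
      K.starProjection (iteratedFDeriv ℝ 2 u y m) := by
    have := K.starProjection.iteratedFDeriv_comp_left (f := u) (x := y) hu.contDiffAt (i := 2)
      le_rfl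
    rw [show (fun x => K.starProjection (u x)) = K.starProjection ∘ u from rfl, this]
    rfl
  have h2 : K.starProjection (iteratedFDeriv ℝ 2 u y m) = 0 := by
    rw [← h1, h0, iteratedFDeriv_const_of_ne (by norm_num)]
    rfl
  rwa [starProjection_apply, coe_eq_zero, orthogonalProjectionOnto_eq_zero_iff] at h2

omit [FiniteDimensional ℝ E'] [FiniteDimensional ℝ V] in
/-- On the model space, `mvfderiv` of `L + u` is `L + Du`. [folklore] -/
theorem mvfderiv_linear_add (L : E' →L[ℝ] V) {u : E' → V} (hu : Differentiable ℝ u) (y : E') :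
    mvfderiv 𝓘(ℝ, E') (fun x => L x + u x) y = L + fderiv ℝ u y := by
  rw [mvfderiv, mfderiv_eq_fderiv]
  change fderiv ℝ (fun x => L x + u x) y = _
  rw [fderiv_fun_add (L.differentiableAt) (hu y), L.fderiv]

/-- `2 ≤ ∞` in `ℕ∞ω`. [folklore] -/
private theorem two_le_infty' : ((2 : ℕ) : ℕ∞ω) ≤ ∞ := WithTop.coe_le_coe.mpr le_top

variable [(euclideanMetric V).HasLeviCivita]

/-- **White's nonparametric system, pointwise** (White 2005, (11) p. 1505): see the module
docstring. Hypotheses: `L` a linear isometry with `K = range L`, `u` smooth with values in `Kᗮ`,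
`f = L + u` a (spacelike) immersion with orthonormal smooth unit normal fields `ν₁, ν₂`,
`dim V = dim E' + 2`, `b` an `f^*δ`-orthonormal basis at `y`, `w ∈ Kᗮ`.
[cite: White2005, §8.4 (11)–(12)] -/
theorem vertical_sub_sum_iteratedFDeriv_eq (L : E' →ₗᵢ[ℝ] V) {u ν₁ ν₂ : E' → V}
    (hu : ContDiff ℝ ∞ u) (huK : ∀ x, u x ∈ (LinearMap.range L.toLinearMap)ᗮ)
    (hpb : contMDiff_pullbackBilin 𝓘(ℝ, V) V 𝓘(ℝ, E') E' ∞)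
    (hf : (euclideanMetric V).IsSpacelikeImmersion 𝓘(ℝ, E') (fun x => L x + u x))
    (hν₁ : ContMDiff 𝓘(ℝ, E') 𝓘(ℝ, V) ∞ ν₁) (hν₂ : ContMDiff 𝓘(ℝ, E') 𝓘(ℝ, V) ∞ ν₂)
    (hn₁ : (euclideanMetric V).IsUnitNormal 𝓘(ℝ, E') (fun x => L x + u x) ν₁ 1)
    (hn₂ : (euclideanMetric V).IsUnitNormal 𝓘(ℝ, E') (fun x => L x + u x) ν₂ 1)
    (h₁₂ : ∀ y, ⟪ν₁ y, ν₂ y⟫ = 0) (hdim : finrank ℝ V = finrank ℝ E' + 2)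
    {y : E'} {ι : Type*} [Fintype ι] (b : Module.Basis ι ℝ (TangentSpace 𝓘(ℝ, E') y))
    (hb : ((euclideanMetric V).inducedMetric (fun x => L x + u x) hpb hf).IsOrthonormalFrame y b)
    {w : V} (hw : w ∈ (LinearMap.range L.toLinearMap)ᗮ) :
    w - ∑ i, iteratedFDeriv ℝ 2 u y ![b i, b i] =
      (LinearMap.range L.toLinearMap)ᗮ.starProjection
          ((LinearMap.range (mvfderiv 𝓘(ℝ, E') (fun x => L x + u x) y).toLinearMap)ᗮ.starProjection
              w
            + ((euclideanMetric V).meanCurvature (fun x => L x + u x) hpb hf ν₁ y) • ν₁ y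
            + ((euclideanMetric V).meanCurvature (fun x => L x + u x) hpb hf ν₂ y) • ν₂ y)
        - fderiv ℝ u y (L.toContinuousLinearMap.adjoint
          ((LinearMap.range (mvfderiv 𝓘(ℝ, E') (fun x => L x + u x) y).toLinearMap)ᗮ.starProjection
              w
            + ((euclideanMetric V).meanCurvature (fun x => L x + u x) hpb hf ν₁ y) • ν₁ y
            + ((euclideanMetric V).meanCurvature (fun x => L x + u x) hpb hf ν₂ y) • ν₂ y)) := by
  set K := LinearMap.range L.toLinearMap with hK
  set A := mvfderiv 𝓘(ℝ, E') (fun x => L x + u x) y with hA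
  set T := LinearMap.range A.toLinearMap with hT
  set H₁ := (euclideanMetric V).meanCurvature (fun x => L x + u x) hpb hf ν₁ y with hH₁
  set H₂ := (euclideanMetric V).meanCurvature (fun x => L x + u x) hpb hf ν₂ y with hH₂
  set S := ∑ i, iteratedFDeriv ℝ 2 u y ![b i, b i] with hS
  have hu2 : ContDiff ℝ 2 u := hu.of_le (by exact_mod_cast two_le_infty')
  -- `S ∈ Kᗮ`, so `E := w - S ∈ Kᗮ`
  have hSK : S ∈ Kᗮ := Kᗮ.sum_mem fun i _ => iteratedFDeriv_two_mem_orthogonal K hu2 huK y _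
  have hEK : w - S ∈ Kᗮ := Kᗮ.sub_mem hw hSK
  -- the differential: `A = L + Du(y)`, values of `Du(y)` in `Kᗮ`
  have hAd : A = L.toContinuousLinearMap + fderiv ℝ u y :=
    mvfderiv_linear_add L.toContinuousLinearMap (hu.differentiable (by simp)) y
  have hDK : ∀ x, fderiv ℝ u y x ∈ Kᗮ := fun x => by
    -- first derivatives of a `Kᗮ`-valued map are `Kᗮ`-valued
    have h0 : (fun z => K.starProjection (u z)) = fun _ => (0 : V) := by
      funext z
      rw [starProjection_apply, (orthogonalProjectionOnto_eq_zero_iff).2 (huK z), coe_zero]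
    have h1 : fderiv ℝ (fun z => K.starProjection (u z)) y x =
        K.starProjection (fderiv ℝ u y x) := by
      rw [show (fun z => K.starProjection (u z)) = K.starProjection ∘ u from rfl,
        fderiv_comp y K.starProjection.differentiableAt (hu.differentiable (by simp) y),
        K.starProjection.fderiv]
      rfl
    have h2 : K.starProjection (fderiv ℝ u y x) = 0 := by
      rw [← h1, h0, fderiv_const_apply]; rfl
    rwa [starProjection_apply, coe_eq_zero, orthogonalProjectionOnto_eq_zero_iff] at h2
  -- the normal part of `S` is the mean curvature vector
  have hnormS : Tᗮ.starProjection S = -H₁ • ν₁ y - H₂ • ν₂ y := by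
    have h := starProjection_sum_iteratedFDeriv_eq_meanCurvatureVector hpb hf
      ((L.toContinuousLinearMap.contDiff.add hu).of_le (by exact_mod_cast two_le_infty'))
      hν₁ hν₂ hn₁ hn₂ h₁₂ hdim b hb
    have hsum : ∑ i, iteratedFDeriv ℝ 2 (fun x => L x + u x) y ![b i, b i] = S :=
      Finset.sum_congr rfl fun i _ =>
        iteratedFDeriv_two_linear_add L.toContinuousLinearMap hu2 y _
    rw [hsum] at h
    exact h
  -- White's identity for the vertical vector `E = w - S`
  have hT' : T = LinearMap.range (L.toLinearMap + ((fderiv ℝ u y : E' →L[ℝ] V) : E' →ₗ[ℝ] V)) := by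
    rw [hT, hAd]; rfl
  have gen : ∀ {T₀ : Submodule ℝ V},
      T₀ = LinearMap.range (L.toLinearMap + ((fderiv ℝ u y : E' →L[ℝ] V) : E' →ₗ[ℝ] V)) →
      w - S = Kᗮ.starProjection ((w - S) - T₀.starProjection (w - S)) -
        fderiv ℝ u y (L.toContinuousLinearMap.adjoint ((w - S) - T₀.starProjection (w - S))) := by
    intro T₀ hT₀
    subst hT₀
    exact vertical_eq_of_normalPart L hDK hEK
  have hWhite := gen hT'
  -- `E - P_T E = P_{Tᗮ} E = P_{Tᗮ} w - P_{Tᗮ} S = β`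
  have hβ : (w - S) - T.starProjection (w - S) = Tᗮ.starProjection w + H₁ • ν₁ y + H₂ • ν₂ y := by
    have h := starProjection_add_starProjection_orthogonal (K := T) (w - S)
    rw [eq_sub_of_add_eq' h |>.symm, map_sub, hnormS, neg_smul]
    abel
  rw [hβ] at hWhite
  exact hWhite

end Literature.Geometry.Riemannian
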